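import Mathlib

/-!
# The generic generation-2 state of the stuck Cappell–Shaneson class `x = (37, 155, 70)` (solo-blind s6)

Exact identities behind `paper/cs-gompf-classes.md` §4c R19 (vi) (solo seat `solo-SmoothPoincare4-blind`).

*Setting.* States of the Gompf move system are pairs `(c, d)` with `d ∣ f_t(c)`,
`f_t(c) = c³ - t c² + (t - 1) c - 1` (the `csCharPoly` of `SoloBlindStatesAsPoints`; this file is self-contained and
re-introduces it as `fPoly` over any commutative ring).  The stuck class of
trace `70` is represented by `x = (37, 155)`, which lives on the traces `t = 70 + 155 k`.  Numerically
(LLL search, every `k` tested) the smallest representative of the ideal class of `x` on such a fibre other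
than `x` itself is the state
`𝒥₁(k) = (c'(k), d'(k)) = (504 k² + 473 k + 110, 1008 k² + 874 k + 189)`,
obtained from `x` by the fibre-independent short element `(14 θ² + 3 θ - 8)/155`.

*What is certified here* (pure polynomial algebra over `ℤ`, all `k`):
1. `generic_state_dvd`: `d'(k) ∣ f_{70 + 155 k}(c'(k))` — so `𝒥₁(k)` IS a state on the fibre `70 + 155 k`
   for every integer `k` (explicit cofactor `127008 k⁴ + 208404 k³ + 123285 k² + 30617 k + 2601`).
2. `generic_state_inv`: `(c'(k) - 1) · (56 k + 26) + 1 = d'(k) · (28 k + 15)` — the inverse of `c' - 1`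
   modulo `d'` is the DEGREE-ONE polynomial `-(56 k + 26)`.
3. `generic_state_cusp₀`, `generic_state_cusp₁`: `2 c'(k) - d'(k) = 72 k + 31` and
   `(72 k + 31)(56 k + 26) = 4 d'(k) + (112 k + 50)`.  With `A = 72 k + 31` these say
   `A ≡ 2 c'` and `A · (c' - 1)⁻¹ ≡ -(112 k + 50)` modulo `d'`, i.e. the cusp vector
   `(A, A/c', A/(c'-1)) ≡ (72 k + 31, 2, -(112 k + 50))`, whence the cusp invariant
   `λ(𝒥₁(k)) ≤ 2 (72 k + 31)(112 k + 50) = 16 d'(k) + 160 k + 76` (`generic_state_lambda_bound`) — the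
   conserved cusp margin `μ = λ/d' → 16` of the escape chains of R19 (v).
4. THE NORM QUADRATIC (R19 (ix)).  For `G = A x² + B x + C` the norm of `G(θ)` from the fibre `t`
   (`θ` a root of `f_t`) is the resultant `Res(f_t, G)`, a QUADRATIC in `t`:
   `normForm A B C t = A·C·(A+B+C)·t² + E₁(A,B,C)·t + E₀(A,B,C)` with leading coefficient the cusp product
   `A · G(0) · G(1)`.  Certified here in the root form: if `G = A (x - r₁)(x - r₂)` (Vieta:
   `B = -A (r₁ + r₂)`, `C = A r₁ r₂`) then `A³ · f_t(r₁) · f_t(r₂) = normForm A B C t`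
   (`normForm_vieta`), and the PENCIL identity `f_t(r) = -(r² - r) · (t - φ(r))`,
   `φ(r) = (r³ - r - 1)/(r² - r)` (`fPoly_pencil`): so the zeros of the norm quadratic in `t` are
   exactly `φ(r₁), φ(r₂)` and `N_t(G(θ)) = A·G(0)·G(1)·(t - φ(r₁))(t - φ(r₂))`.  Since every element of
   `J⁻¹ ∖ O` has `A ≢ 0 (mod d)` and `(G(0), G(1)) ≡ (A/c, A/(c-1))`, the leading coefficient is `≥ λ(J)`
   in absolute value: small representatives on far fibres `t'` are exactly near-coincidences of `t'` with
   `φ` of a root of some `G` in the (fibre-independent) inverse lattice of `J`.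
Nothing here depends on unverified numerics; the INTERPRETATION (that `𝒥₁(k)` is the smallest other
representative, and that `λ` governs the escape law) is the empirical part and is not claimed.
-/

namespace Summit.SmoothPoincare4.SmoothPoincare4.Theorems

/-- Norm of the generic generation-2 state of `x = (37,155)` on the fibre `70 + 155 k`. -/
def genericD (k : ℤ) : ℤ := 1008 * k ^ 2 + 874 * k + 189

/-- Generator residue of the generic generation-2 state. -/
def genericC (k : ℤ) : ℤ := 504 * k ^ 2 + 473 * k + 110

/-- `𝒥₁(k) = (genericC k, genericD k)` is a state on the fibre `70 + 155 k` for every `k`: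
`d'(k)` divides `f_{70+155k}(c'(k))`, with an explicit quartic cofactor. -/
theorem generic_state_dvd (k : ℤ) :
    genericD k ∣ (genericC k) ^ 3 - (70 + 155 * k) * (genericC k) ^ 2 + (70 + 155 * k - 1) * genericC k - 1 :=
  ⟨127008 * k ^ 4 + 208404 * k ^ 3 + 123285 * k ^ 2 + 30617 * k + 2601,
    by unfold genericD genericC; ring⟩

/-- Sanity instance `k = 27` (fibre `4255`): the state `(380297, 758619)` found by the LLL search. -/
example : genericC 27 = 380297 ∧ genericD 27 = 758619 := by
  unfold genericC genericD; norm_num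

/-- The inverse of `c'(k) - 1` modulo `d'(k)` has degree one: `(c' - 1)(56k + 26) + 1 = d'(28k + 15)`. -/
theorem generic_state_inv (k : ℤ) :
    (genericC k - 1) * (56 * k + 26) + 1 = genericD k * (28 * k + 15) := by
  unfold genericC genericD; ring

/-- Hence `(c' - 1) · (-(56 k + 26)) ≡ 1 (mod d')`. -/
theorem generic_state_inv_modEq (k : ℤ) :
    (genericC k - 1) * (-(56 * k + 26)) ≡ 1 [ZMOD genericD k] := by
  have h := generic_state_inv k
  refine (Int.modEq_iff_dvd.mpr ⟨28 * k + 15, ?_⟩)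
  linear_combination h

/-- Cusp `0`: the short vector `A = 72 k + 31` satisfies `A = 2 c' - d'`, so `A ≡ 2 · c' (mod d')`
(its value at the cusp `0` is `A / c' ≡ 2`). -/
theorem generic_state_cusp₀ (k : ℤ) : 2 * genericC k - genericD k = 72 * k + 31 := by
  unfold genericC genericD; ring

/-- Cusp `1`: `(72 k + 31)(56 k + 26) = 4 d' + (112 k + 50)`, so with `(c'-1)⁻¹ ≡ -(56k+26)` the value
of `A` at the cusp `1` is `A / (c' - 1) ≡ -(112 k + 50) (mod d')`. -/
theorem generic_state_cusp₁ (k : ℤ) :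
    (72 * k + 31) * (56 * k + 26) = 4 * genericD k + (112 * k + 50) := by
  unfold genericD; ring

/-- The two cusp congruences as `ZMOD` statements. -/
theorem generic_state_cusp_modEq (k : ℤ) :
    (72 * k + 31) ≡ 2 * genericC k [ZMOD genericD k] ∧
    (72 * k + 31) * (-(56 * k + 26)) ≡ -(112 * k + 50) [ZMOD genericD k] := by
  constructor
  · exact Int.modEq_iff_dvd.mpr ⟨1, by unfold genericC genericD; ring⟩
  · exact Int.modEq_iff_dvd.mpr ⟨4, by unfold genericD; ring⟩

/-- The resulting bound on the cusp invariant: the product of the cusp vector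
`(72k+31, 2, 112k+50)` equals `16 d'(k) + 160 k + 76` — cusp margin `16 + O(1/k)`. -/
theorem generic_state_lambda_bound (k : ℤ) :
    (72 * k + 31) * 2 * (112 * k + 50) = 16 * genericD k + 160 * k + 76 := by
  unfold genericD; ring

/-- `d'(k)` is odd and positive for every `k`, so the state is a genuine (nonzero-modulus) state and `2` is
invertible mod `d'` (used in reading `A ≡ 2 c'` as `A / c' ≡ 2`). -/
theorem genericD_pos (k : ℤ) : 0 < genericD k := by
  unfold genericD
  by_cases h : 0 ≤ k
  · nlinarith [sq_nonneg k]
  · have h' : k ≤ -1 := by omega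
    nlinarith [mul_nonneg (by omega : (0:ℤ) ≤ -k) (by omega : (0:ℤ) ≤ -k - 1)]

/-- `d'(k)` is odd (the real roots of `1008 k² + 874 k + 189` lie in `(-0.46, -0.41)`, so positivity
needs integrality; oddness makes `2` a unit mod `d'`). -/
theorem genericD_odd (k : ℤ) : Odd (genericD k) := by
  unfold genericD
  rcases Int.even_or_odd k with ⟨m, hm⟩ | ⟨m, hm⟩
  · exact ⟨1008 * 2 * m ^ 2 + 874 * m + 94, by subst hm; ring⟩
  · exact ⟨2016 * m ^ 2 + 2016 * m + 504 + 874 * m + 437 + 94, by subst hm; ring⟩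

/-! ### The norm quadratic and the pencil `φ = (x³ - x - 1)/(x² - x)` -/

section NormForm
variable {R : Type*} [CommRing R]

/-- Coefficient of `t¹` of the norm quadratic of `A x² + B x + C`. -/
def normE₁ (A B C : R) : R := B * C ^ 2 + B ^ 2 * C + A * B ^ 2 + A ^ 2 * B - A * B * C - 4 * A ^ 2 * C - 2 * A * C ^ 2

/-- Coefficient of `t⁰` of the norm quadratic of `A x² + B x + C`. -/
def normE₀ (A B C : R) : R := A ^ 3 + B ^ 3 + C ^ 3 + A ^ 2 * C - A ^ 2 * B - B ^ 2 * C + 2 * A * C ^ 2 - 3 * A * B * C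

/-- The norm quadratic `Res_x(x³ - t x² + (t-1) x - 1, A x² + B x + C)` as a polynomial in `t`:
leading coefficient = the cusp product `A · G(0) · G(1)`. -/
def normForm (A B C t : R) : R := A * C * (A + B + C) * t ^ 2 + normE₁ A B C * t + normE₀ A B C

/-- The generic cubic `f_t(r) = r³ - t r² + (t - 1) r - 1` over any commutative ring. -/
def fPoly (t r : R) : R := r ^ 3 - t * r ^ 2 + (t - 1) * r - 1


/-- ROOT FORM of the resultant: if `G = A (x - r₁)(x - r₂)`, i.e. `B = -A (r₁ + r₂)` and `C = A r₁ r₂`,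
then `A³ f_t(r₁) f_t(r₂)` equals the norm quadratic.  (With `θ₁, θ₂, θ₃` the roots of `f_t`,
`∏ G(θᵢ) = A³ ∏ᵢ (θᵢ - r₁)(θᵢ - r₂) = A³ f_t(r₁) f_t(r₂)`; this identity is what makes `normForm` the norm.) -/
theorem normForm_vieta (A r₁ r₂ t : R) :
    A ^ 3 * fPoly t r₁ * fPoly t r₂ = normForm A (-A * (r₁ + r₂)) (A * r₁ * r₂) t := by
  unfold fPoly normForm normE₁ normE₀; ring

/-- Sanity instance: the short element `14 θ² + 3 θ - 8` of `x = (37, 155)` at `t = 70` has norm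
`-155² · 189` (so `(14 θ² + 3 θ - 8) = x̄ · 𝒥₁(0)` with `N(𝒥₁(0)) = 189 = genericD 0`). -/
example : normForm (14 : ℤ) 3 (-8) 70 = -(155 ^ 2 * 189) := by
  unfold normForm normE₁ normE₀; norm_num

/-- The norm quadratic of the short element of `x` along the whole progression `t = 70 + 155 k`:
`N(14 θ² + 3 θ - 8) = -155² · d'(k)` — the generic generation-2 state has norm EXACTLY `genericD k`. -/
theorem normForm_shortElement (k : ℤ) :
    normForm (14 : ℤ) 3 (-8) (70 + 155 * k) = -(155 ^ 2 * genericD k) := by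
  unfold normForm normE₁ normE₀ genericD; ring


/-- SHADOW FORM of the norm quadratic (R21): in the variables `A`, `S = A(t-1) + B`, `u = C - A` (= `u₁ = G(0) - A`),
`N_t(G) = -A·S·u·t² + E₁′ t + E₀′` with `E₁′, E₀′` cubic forms in `(A, S, u)`.  Since `(A, S, u₁) ≡ A·(1, c-1, -(c-1)/c) (mod d)`
(cusp lemma), `|A·S·u₁| ≥ λ(J)`: this is the one-line source of the escape law `min N ≈ λ t²/d²`. -/
theorem normForm_shadow (A S u t : R) :
    normForm A (S - A * (t - 1)) (u + A) t =
      -(A * S * u) * t ^ 2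
      + (A ^ 2 * S - A ^ 2 * u - A * S ^ 2 + 5 * A * S * u - A * u ^ 2 + S ^ 2 * u + S * u ^ 2) * t
      + (A ^ 3 - 3 * A ^ 2 * S + 4 * A ^ 2 * u + 2 * A * S ^ 2 - 5 * A * S * u + 5 * A * u ^ 2 + S ^ 3 - S ^ 2 * u + u ^ 3) := by
  unfold normForm normE₁ normE₀; ring

/-- The same as a monic CUBIC in `u` (for fixed `A, S, t` the norm is `∏ᵢ (u - uᵢ*)` with three real centres
`u₁* ≈ -(t-1)S - A`, `u₂* ≈ A(t-4) - S + S/t`, `u₃* ≈ -S/t`; the admissible `u` form one residue class mod `d`). -/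
theorem normForm_cubic_in_u (A S u t : R) :
    normForm A (S - A * (t - 1)) (u + A) t =
      u ^ 3 + ((S - A) * t + 5 * A) * u ^ 2
      + (-(A * S) * t ^ 2 + (5 * A * S + S ^ 2 - A ^ 2) * t + 4 * A ^ 2 - 5 * A * S - S ^ 2) * u
      + (A ^ 3 + S ^ 3 + (A ^ 2 * S - A * S ^ 2) * t - 3 * A ^ 2 * S + 2 * A * S ^ 2) := by
  unfold normForm normE₁ normE₀; ring

end NormForm

section Pencil
variable {K : Type*} [Field K]

/-- THE PENCIL IDENTITY (ring form `f_t(r) = -((r² - r)t - (r³ - r - 1))`, any commutative ring): away from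
the cusps `r = 0, 1`, `f_t(r) = -(r² - r) · (t - φ(r))` with `φ(r) = (r³ - r - 1)/(r² - r)`.  Hence `f_t(r) = 0 ↔ t = φ(r)`,
and by `normForm_vieta` the zeros (in `t`) of the norm quadratic of `A (x - r₁)(x - r₂)` are `φ(r₁), φ(r₂)`:
`N_t = A · G(0) · G(1) · (t - φ(r₁)) · (t - φ(r₂))` (`normForm_roots`). -/
theorem fPoly_pencil_ring {R : Type*} [CommRing R] (t r : R) :
    fPoly t r = -((r ^ 2 - r) * t - (r ^ 3 - r - 1)) := by
  unfold fPoly; ring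

/-- The pencil identity with the division performed (in a field, off the cusps). -/
theorem fPoly_pencil (t r : K) (h : r ^ 2 - r ≠ 0) :
    fPoly t r = -(r ^ 2 - r) * (t - (r ^ 3 - r - 1) / (r ^ 2 - r)) := by
  have e : (r ^ 2 - r) * (t - (r ^ 3 - r - 1) / (r ^ 2 - r)) = (r ^ 2 - r) * t - (r ^ 3 - r - 1) := by
    rw [mul_sub, mul_comm (r ^ 2 - r) ((r ^ 3 - r - 1) / (r ^ 2 - r)), div_mul_cancel₀ _ h]
  rw [fPoly_pencil_ring, neg_mul, e]

/-- `f_t(r) = 0 ↔ t = φ(r)` off the cusps. -/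
theorem fPoly_eq_zero_iff (t r : K) (h : r ^ 2 - r ≠ 0) :
    fPoly t r = 0 ↔ t = (r ^ 3 - r - 1) / (r ^ 2 - r) := by
  rw [fPoly_pencil_ring, neg_eq_zero, sub_eq_zero, eq_div_iff h, mul_comm]

/-- The fully factorised norm quadratic: for `G = A (x - r₁)(x - r₂)` with `r₁, r₂ ∉ {0, 1}`,
`normForm = A · G(0) · G(1) · (t - φ(r₁)) · (t - φ(r₂))`, where `G(0) = A r₁ r₂` and
`G(1) = A (1 - r₁)(1 - r₂)`. -/
theorem normForm_roots (A r₁ r₂ t : K) (h₁ : r₁ ^ 2 - r₁ ≠ 0) (h₂ : r₂ ^ 2 - r₂ ≠ 0) :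
    normForm A (-A * (r₁ + r₂)) (A * r₁ * r₂) t =
      A * (A * r₁ * r₂) * (A * (1 - r₁) * (1 - r₂)) *
        (t - (r₁ ^ 3 - r₁ - 1) / (r₁ ^ 2 - r₁)) * (t - (r₂ ^ 3 - r₂ - 1) / (r₂ ^ 2 - r₂)) := by
  rw [← normForm_vieta, fPoly_pencil t r₁ h₁, fPoly_pencil t r₂ h₂]
  ring

end Pencil

/-! ### The cusp lemma (ring form): all cusp values of an inverse-lattice element are `A` times units

For a state `J = (d, θ - c)` the colon lattice is `(O : J) = d⁻¹ · {G(θ) : G = A x² + B x + C,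
B ≡ (c - t) A, C c ≡ A (mod d)}` (paper §4c (ix)).  Read in `R = ℤ/d` (or any commutative ring in which
`c` is a root of `f_t` and the two congruences are equalities) the values of `G` at the three cusps
`0, 1, ∞` of the pencil and at `t - 1`, and the "shadow" combinations `S = A(t-1) + B`, `G(0) - A`,
`G(1) + A`, `S + A` used in Theorem G1, are ALL `A` times explicit units built from `c`, `c - 1`,
`c + 1 - t` (whose product is `1`).  This is the algebraic heart of the generation-one escape theorem:
no cusp value of a non-trivial lattice element vanishes mod `d`, and every triple of them is a rescaled
permutation of `(c(c-1), c-1, c)`, hence has product `≥ λ(J)` in absolute value. -/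

section CuspLemma
variable {R : Type*} [CommRing R]

/-- A root `c` of `f_t` is a unit: `c · (c-1) · (c+1-t) = 1` (this is `f_t(c) = 0` rewritten). -/
theorem root_unit (t c : R) (hf : fPoly t c = 0) : c * ((c - 1) * (c + 1 - t)) = 1 := by
  unfold fPoly at hf; linear_combination hf

/-- CUSP LEMMA, ring form.  Hypotheses: `f_t(c) = 0`, `B = (c - t) A`, `C c = A` (the colon-lattice
congruences).  Conclusions, for `G = A x² + B x + C`:
`G(0) = C = A (c-1)(c+1-t)` (`= A/c`), `G(1)·(c-1) = A`, `G(t-1) = A c (c-1)`, `S := A(t-1) + B = A(c-1)`,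
`G(0) - A = -A (c-1)² (c+1-t)` (`= -A(c-1)/c`), `(G(1) + A)(c-1) = A c`, `S + A = A c`. -/
theorem cusp_lemma (t c A B C : R) (hf : fPoly t c = 0) (hB : B = (c - t) * A) (hC : C * c = A) :
    C = A * ((c - 1) * (c + 1 - t)) ∧
    (A + B + C) * (c - 1) = A ∧
    A * (t - 1) ^ 2 + B * (t - 1) + C = A * c * (c - 1) ∧
    A * (t - 1) + B = A * (c - 1) ∧
    C - A = -(A * (c - 1) ^ 2 * (c + 1 - t)) ∧
    (A + B + C + A) * (c - 1) = A * c ∧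
    A * (t - 1) + B + A = A * c := by
  unfold fPoly at hf
  have hC' : C = A * ((c - 1) * (c + 1 - t)) := by
    linear_combination (-C) * hf + ((c - 1) * (c + 1 - t)) * hC
  refine ⟨hC', ?_, ?_, ?_, ?_, ?_, ?_⟩
  · linear_combination (c - 1) * hB + (c - 1) * hC' + A * hf
  · linear_combination (t - 1) * hB + hC'
  · linear_combination hB
  · linear_combination hC' + A * hf
  · linear_combination (c - 1) * hB + (c - 1) * hC' + A * hf
  · linear_combination hB

/-- The same over `ℤ/d` from integer data: `d ∣ f_t(c)` and the two lattice congruences give the seven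
cusp congruences modulo `d`. -/
theorem cusp_lemma_zmod (d : ℕ) (t c A B C : ℤ) (hf : (d : ℤ) ∣ fPoly t c)
    (hB : B ≡ (c - t) * A [ZMOD d]) (hC : C * c ≡ A [ZMOD d]) :
    C ≡ A * ((c - 1) * (c + 1 - t)) [ZMOD d] ∧
    (A + B + C) * (c - 1) ≡ A [ZMOD d] ∧
    A * (t - 1) ^ 2 + B * (t - 1) + C ≡ A * c * (c - 1) [ZMOD d] ∧
    A * (t - 1) + B ≡ A * (c - 1) [ZMOD d] ∧
    C - A ≡ -(A * (c - 1) ^ 2 * (c + 1 - t)) [ZMOD d] ∧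
    (A + B + C + A) * (c - 1) ≡ A * c [ZMOD d] ∧
    A * (t - 1) + B + A ≡ A * c [ZMOD d] := by
  have hf' : fPoly (t : ZMod d) (c : ZMod d) = 0 := by
    have h0 : fPoly t c ≡ 0 [ZMOD d] := Int.modEq_zero_iff_dvd.mpr hf
    have h1 := (ZMod.intCast_eq_intCast_iff _ _ _).mpr h0
    unfold fPoly at h1 ⊢
    push_cast at h1
    linear_combination h1
  have hB' : ((B : ℤ) : ZMod d) = ((c : ZMod d) - t) * A := by
    have h1 := (ZMod.intCast_eq_intCast_iff _ _ _).mpr hB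
    push_cast at h1; exact h1
  have hC' : ((C : ℤ) : ZMod d) * c = A := by
    have h1 := (ZMod.intCast_eq_intCast_iff _ _ _).mpr hC
    push_cast at h1; exact h1
  obtain ⟨h1, h2, h3, h4, h5, h6, h7⟩ := cusp_lemma (t : ZMod d) c A B C hf' hB' hC'
  refine ⟨?_, ?_, ?_, ?_, ?_, ?_, ?_⟩ <;>
    (apply (ZMod.intCast_eq_intCast_iff _ _ _).mp; push_cast; assumption)


/-- THE COLON LATTICE, reduction identity: `(x - c)·G(x) = A·f_t(x) + [(B - cA + tA) x² + (C - cB - (t-1)A) x + (A - cC)]`.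
Hence `G(θ)(θ - c) ∈ d·ℤ[θ]` (i.e. `G(θ)/d ∈ (O : J)` for `J = (d, θ - c)`) iff the three bracket
coefficients vanish mod `d`: `B ≡ (c - t)A`, `cC ≡ A`, and `C - cB - (t-1)A ≡ 0` — the last being implied by
the first two when `f_t(c) ≡ 0` (`colon_third`).  So `(O : J) = d⁻¹·Λ_J` with `Λ_J` cut out by two
congruences, independent of the fibre `t` within `t ≡ t₀ (mod d)`, for EVERY state (invertible or not). -/
theorem colon_reduction (A B C c t x : R) :
    (x - c) * (A * x ^ 2 + B * x + C) =
      A * fPoly t x + ((B - c * A + t * A) * x ^ 2 + (C - c * B - (t - 1) * A) * x + (A - c * C)) := by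
  unfold fPoly; ring

/-- The third colon congruence follows from the first two at a root of `f_t`. -/
theorem colon_third (t c A B C : R) (hf : fPoly t c = 0) (hB : B = (c - t) * A) (hC : C * c = A) :
    C - c * B - (t - 1) * A = 0 := by
  unfold fPoly at hf
  have hC' : C = A * ((c - 1) * (c + 1 - t)) := by
    linear_combination (-C) * hf + ((c - 1) * (c + 1 - t)) * hC
  linear_combination hC' - c * hB

end CuspLemma

end Summit.SmoothPoincare4.SmoothPoincare4.Theorems
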